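import Summits.HodgeConjecture.HodgeConjecture.Theses.PadicSemiregularLift
import Summits.HodgeConjecture.HodgeConjecture.Theorems.PadicSemiregularLiftHodgeAbelianVarietiesStarSeedsEngine
import Summits.HodgeConjecture.HodgeConjecture.Theorems.PadicSemiregularLiftFermatAnchorAssemblyDefs
import Literature.AlgebraicGeometry.Crystalline.PadicAnchorDefs
import Literature.AlgebraicGeometry.HodgeTheory.ComplexConjugationHolds
import Literature.AlgebraicGeometry.Motives.AbelianVarietyProjectiveChart

/-!
# Disproof of `FermatAnchorAssembly` (stmt-HodgeConjecture-14874) — standing disprover's work file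

Crux (route `PadicSemiregularLift`, rank 9, glue node):
`FermatAnchorAssembly := PadicPridhamSemiregularity → FormalLiftingFromClassLifting →
FormalVectorBundlesAlgebraize → HodgeFermatVarieties` (P1b → P1a → P3a → HC for every complex Fermat
hypersurface `Xⁿₘ`).

## Findings (cycle 1, cdisprove-14874-0, 2026-08-16) — NO KILL; why it resists

1. STRUCTURE (§1, kernel-checked). `¬ FermatAnchorAssembly ↔ (P1b ∧ P1a ∧ P3a) ∧ ¬ HodgeFermatVarieties`
   (`not_fermatAnchorAssembly_iff`): a disproof must (i) PROVE the whole typed engine and (ii) exhibit a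
   non-algebraic Hodge class on a complex Fermat hypersurface, i.e. refute the Hodge conjecture
   (`not_hodgeConjecture_of_not_fermatAnchorAssembly`). Conversely the crux follows from
   `HodgeFermatVarieties` alone and from `HodgeConjecture` (`…_of_hodgeFermatVarieties`, `…_of_hodgeConjecture`),
   and given the engine it is EQUIVALENT to `HodgeFermatVarieties` (`…_iff_hodgeFermatVarieties_of_engine`).
2. LOAD-BEARING ANALYSIS (§1). Dropping any of h1b/h1a/h3a gives a statement equivalent, given the two
   others, to `HodgeFermatVarieties` (`without_*_iff`); so no `_false_without_<H>` theorem exists short of a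
   counterexample to HC(Fermat): every hypothesis is "removable iff HC(Fermat) is a theorem". The only
   vacuity route is an INCONSISTENT engine (`fermatAnchorAssembly_of_not_engine`); on paper the engine is
   consistent (P1b: `σ₀∘ob`, `σ₁∘ob` are additive on short exact sequences of locally free lifts, hence factor
   through `K₀(X_{n+1})` and die on classes restricted from `X_{n+2}` — rattack-g3; P3a = Grothendieck
   existence, in print), so this route is closed too.
3. DEGENERATE INSTANCES (§2, kernel-checked). The consequent is FREE in dimension `≤ 1` (Fermat points and
   Fermat curves: no middle codimension; `hodgeFermatVarieties_of_dim_le_one`), so the `∀ n` of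
   `HodgeFermatVarieties` has content from `n = 2` on (in print from `n = 4`, `m ∉ {prime, ≤ 20, …}` on:
   Shioda 1979 / Ran 1980 / Aoki 1987; first open residues `m = 33, 35` per Cruxes/HodgeFermatVarieties).
   `m = 0` is excluded by `IsSmoothProjective`; `m = 1, 2` (`ℙⁿ`, quadrics) are true in print, not in the tree.
4. THE PICKED LINE `Sketch` (§3; stubs `stub_transfer`, `stub_anchors`, `stub_zeroOneSeeds`).
   (a) QUANTIFIER MUTATION (kernel-checked, `hodgeConjectureFor_of_anchoredZeroOneSeeds`): the composition
   consumes only `∃ D : Anchor n X, D.IsGenuine ∧ D.SpansHodge ∧ ZeroOneSeedsFor D.C n D.𝒴` per host; the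
   registered `stub_zeroOneSeeds` (`∀` genuine anchors — including every exotic value of the hypothesis
   structure `CrystallineRealization`, cf. the named-fact warning in `Motives/CrystallineRealization` — and
   `∀ u ∈ U_Hdg` in `∀` middle degrees) is needlessly strong. Recommended merged stub: `AnchoredZeroOneSeeds`
   below (strictly weaker than `stub_anchors ∧ stub_zeroOneSeeds`, `anchoredZeroOneSeeds_of_stubs`).
   (b) TIGHTNESS (tree theorem `PadicAnchor.Anchor.rationalPVHCFor_iff_middleCyclePart`, re-exported as
   `seeds_force_middleCyclePart`): at a genuine spanning anchor with B2 and cycle descent the engine output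
   `RationalPVHCFor` is EQUIVALENT to `MiddleCyclePart` of the host; so `stub_zeroOneSeeds` + `stub_anchors`
   + engine prove HC in the middle degrees for EVERY power of EVERY Fermat Jacobian — the open stub is at least
   that strong (stronger than `HodgeFermatVarieties`), and object-level on top.
   (c) PAPER, CM ANCHORS (docstring of §3): at the superspecial reduction `p ≡ -1 (m)` of `X = J(Cₘ)ᴺ⁺¹`,
   `U_Hdg^r ⊗ ℚ = ⊕_{Hodge Galois orbits O} R_O` (eigen-projectors of the CM torus are ℚ-rational algebraic
   correspondences; `φ` swaps `V_S ↔ V_S̄`; `Fʳ ∩ Tate = type-(r,r)` pairs; a rational class in a NON-Hodge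
   orbit lying in `Fʳ` vanishes by Galois transitivity). Hence `SpansHodge`, `UHdgAreHodge` (B2) and "no fake
   `p`-adic Hodge classes" HOLD on paper at these anchors: `stub_anchors` is print-grade, and the kill switch
   of Cruxes/HodgeAbelianVarieties Finding 17 (a rational fake class) is ABSENT here. Lefschetz classes
   (polynomials in liftable divisors) are reached by LINE BUNDLES alone (polarisation identity for `c₁ʳ/r!`),
   so the open content of the seed stub is exactly the exotic Hodge orbits `Bʳ ∖ Dʳ` of the hosts.
   (d) PAPER + COMPUTATION, NO COARSE NO-GO: the first-order Hodge-locus obstruction of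
   Cruxes/HodgeAbelianVarieties Finding 14 (card rule R3: `T₀HL(ch₁E) ∩ T₀HL(ch₂E) ⊆ T₀HL(ch_qE)` for a
   `{0,1}`-semiregular `E`) kills a target `c` for ALL seeds only if `𝔥₂ := T₀HL(B¹(X)) ∩ T₀HL(B²(X)) ⊄ Ann(c)`.
   On a CM host the Hodge classes `⊗ ℂ` have a monomial eigenbasis, `Ann` is computed monomial-wise, and
   `ξ = Σ x_{(α,i)(β,j)} ξ_{(α,i)→(β,j)} ∈ T₀HL(B¹)` forces `x_{(α,i),·} = 0` as soon as `(α,i)` has TWO Hodge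
   partners `(ψ,j)` (`{(α,i),(ψ,j)}` a Hodge pair); the partners of `(α,i)` are the `(χ̄,j)` with `T_χ = T_α`
   (same CM-type pattern) in ANY copy `j`. Hence `T₀HL(B¹(Aᴺ⁺¹)) = 0` for `N ≥ 1` (two copies), and for
   `X = J(Cₘ)` itself `T₀HL(B¹) = 0` unless some character has a unique partner — `kit/partners.py` (local,
   `3 ≤ m ≤ 72`): this happens EXACTLY for `m ≡ 3 (mod 6)`, for the two characters `(m/3,m/3)`, `(2m/3,2m/3)`
   of the multiplicity-one elliptic factor `E = A_{(m/3,m/3,m/3)} ≅ E_{ζ₃}` (then `T₀HL(B¹(J(Cₘ))) = T Def(E)`,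
   one direction `ξ_E`). But `ξ_E ∉ T₀HL(B²)`: Hodge 4-sets through exactly one of `α, ᾱ` exist
   (`kit/alpha_sets.py`: 729 / 8748 / 864 / 1377 / 1080 of them for `m = 9, 15, 21, 27, 33`, e.g.
   `{(11,11),(1,10),(12,22),(21,22)}` at `m = 33`). So `𝔥₂ = 0` on EVERY host of the line, `N = 0` included:
   Finding 14 is SILENT here (as the card claims); R3 survives only as a per-seed design rule. (The `m = 33`
   avatar of da Silva's class `(1,4,16,25,31,22)` does not even meet `E`: no pair of its entries sums to
   `0 mod 11`.)
   (e) EXOTIC-REALIZATION TWISTS of `D.C` (type-level attack on the `∀ D`): rescaling `chCris_r` by units is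
   harmless (closures rescale); zeroing `chCris_r`, `r ≥ 2`, keeps every axiom but weakens `HodgeCondition`,
   so `IsGenuine.bek` for the twisted `C` becomes an undecidable `Prop` — no kill, only the advice (a).
5. VERDICT. The crux resists because its negation is `engine ∧ ¬HC(Fermat)`; the line's open stub resists
   cheap attacks because (c) removes the fake-class kill switch and (d) removes the coarse deformation no-go;
   what remains is the honest existence problem "`{0,1}`-semiregular Hodge-clean locally free seeds on `E^g`
   reaching an exotic Fermat-type Hodge orbit", `≥` HC(host) by (b). Cheapest decisive computation (lead's /
   next disprover cycle): the card's `(m, host, p) = (57, B₃ × B₆, 113)` isotypic-slope search — EMPTY kills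
   the semi-homogeneous ansatz only, not the stub.

No `sorry` in this file. Namespace `…Cruxes.FermatAnchorAssembly.Disproof`.
-/

set_option linter.dupNamespace false

noncomputable section

open CategoryTheory AlgebraicGeometry
open scoped Isocrystal
open Literature.AlgebraicGeometry Literature.AlgebraicGeometry.Motives
  Literature.AlgebraicGeometry.HodgeTheory Literature.AlgebraicGeometry.Crystalline
  Literature.AlgebraicGeometry.Crystalline.PadicAnchor Literature.AlgebraicGeometry.KTheory
open Summit.HodgeConjecture.HodgeConjecture.Theses.PadicSemiregularLift
open Summit.HodgeConjecture.HodgeConjecture.Cruxes.HodgeAbelianVarieties.InnerFormInvariantSeeds.Engine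
open Summit.HodgeConjecture.HodgeConjecture.Cruxes.FermatAnchorAssembly.ParallelizableAvatar

namespace Summit.HodgeConjecture.HodgeConjecture.Cruxes.FermatAnchorAssembly.Disproof

/-! ## §1 Structure of the crux: what a disproof must contain -/

/-- The crux follows from its consequent alone: HC for Fermat hypersurfaces gives the glue node with
the engine hypotheses unused. [folklore] -/
theorem fermatAnchorAssembly_of_hodgeFermatVarieties (h : HodgeFermatVarieties) :
    FermatAnchorAssembly :=
  fun _ _ _ => h

/-- The Hodge conjecture (the summit statement) implies `HodgeFermatVarieties`. [folklore] -/
theorem hodgeFermatVarieties_of_hodgeConjecture (h : _root_.HodgeConjecture) : HodgeFermatVarieties :=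
  fun _ _ _ _ hX => h hX

/-- … hence the crux. [folklore] -/
theorem fermatAnchorAssembly_of_hodgeConjecture (h : _root_.HodgeConjecture) : FermatAnchorAssembly :=
  fermatAnchorAssembly_of_hodgeFermatVarieties (hodgeFermatVarieties_of_hodgeConjecture h)

/-- **What a disproof is.** The negation of the crux is EXACTLY: the three typed engine statements hold
and HC fails for some complex Fermat hypersurface. [folklore] -/
theorem not_fermatAnchorAssembly_iff :
    ¬ FermatAnchorAssembly ↔
      (PadicPridhamSemiregularity ∧ FormalLiftingFromClassLifting ∧ FormalVectorBundlesAlgebraize) ∧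
        ¬ HodgeFermatVarieties := by
  constructor
  · intro h
    by_contra hc
    apply h
    intro h1b h1a h3a
    by_contra hF
    exact hc ⟨⟨h1b, h1a, h3a⟩, hF⟩
  · rintro ⟨⟨h1b, h1a, h3a⟩, hF⟩ h
    exact hF (h h1b h1a h3a)

/-- **A disproof of the crux disproves the Hodge conjecture.** [folklore] -/
theorem not_hodgeConjecture_of_not_fermatAnchorAssembly (h : ¬ FermatAnchorAssembly) :
    ¬ _root_.HodgeConjecture :=
  fun hc => h (fermatAnchorAssembly_of_hodgeConjecture hc)

/-- **A disproof of the crux yields a counterexample to HC on a Fermat hypersurface** (the witness any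
refutation must produce). [folklore] -/
theorem exists_fermat_counterexample_of_not (h : ¬ FermatAnchorAssembly) :
    ∃ (n m : ℕ) (X : SchemeOver ℂ), IsFermatVariety n m X ∧ IsSmoothProjective n X ∧
      ¬ HodgeConjectureFor n X := by
  have hF := (not_fermatAnchorAssembly_iff.1 h).2
  unfold HodgeFermatVarieties at hF
  push Not at hF
  obtain ⟨n, m, X, h1, h2, h3⟩ := hF
  exact ⟨n, m, X, h1, h2, h3⟩

/-- Given the engine, the crux is EQUIVALENT to its consequent. [folklore] -/
theorem fermatAnchorAssembly_iff_hodgeFermatVarieties_of_engine (h1b : PadicPridhamSemiregularity)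
    (h1a : FormalLiftingFromClassLifting) (h3a : FormalVectorBundlesAlgebraize) :
    FermatAnchorAssembly ↔ HodgeFermatVarieties :=
  ⟨fun h => h h1b h1a h3a, fermatAnchorAssembly_of_hodgeFermatVarieties⟩

/-- **Vacuity route**: an inconsistent engine proves the crux trivially (and breaks the route — a
refutation of P1b, P1a or P3a is a refutation of a sibling Theses decl, not of this one). [folklore] -/
theorem fermatAnchorAssembly_of_not_engine
    (h : ¬ (PadicPridhamSemiregularity ∧ FormalLiftingFromClassLifting ∧ FormalVectorBundlesAlgebraize)) :
    FermatAnchorAssembly :=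
  fun h1b h1a h3a => (h ⟨h1b, h1a, h3a⟩).elim

/-! ### Load-bearing analysis: each engine hypothesis dropped -/

/-- The crux with h1b (P1b `PadicPridhamSemiregularity`) dropped. [folklore] -/
def WithoutPridham : Prop :=
  FormalLiftingFromClassLifting → FormalVectorBundlesAlgebraize → HodgeFermatVarieties

/-- The crux with h1a (P1a `FormalLiftingFromClassLifting`) dropped. [folklore] -/
def WithoutFormalLifting : Prop :=
  PadicPridhamSemiregularity → FormalVectorBundlesAlgebraize → HodgeFermatVarieties

/-- The crux with h3a (P3a `FormalVectorBundlesAlgebraize`) dropped. [folklore] -/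
def WithoutAlgebraization : Prop :=
  PadicPridhamSemiregularity → FormalLiftingFromClassLifting → HodgeFermatVarieties

/-- The crux with the whole engine dropped is literally `HodgeFermatVarieties`. [folklore] -/
def WithoutEngine : Prop := HodgeFermatVarieties

/-- Each weakening implies the crux (so none is refutable without refuting the crux, i.e. HC). [folklore] -/
theorem fermatAnchorAssembly_of_without :
    (WithoutPridham → FermatAnchorAssembly) ∧ (WithoutFormalLifting → FermatAnchorAssembly) ∧
      (WithoutAlgebraization → FermatAnchorAssembly) ∧ (WithoutEngine → FermatAnchorAssembly) :=
  ⟨fun h _ h1a h3a => h h1a h3a, fun h h1b _ h3a => h h1b h3a, fun h h1b h1a _ => h h1b h1a,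
    fun h _ _ _ => h⟩

/-- **h1b is removable iff HC(Fermat) holds given P1a, P3a**: the weakening is equivalent to the
consequent once the remaining engine items are granted. [folklore] -/
theorem withoutPridham_iff (h1a : FormalLiftingFromClassLifting) (h3a : FormalVectorBundlesAlgebraize) :
    WithoutPridham ↔ HodgeFermatVarieties :=
  ⟨fun h => h h1a h3a, fun h _ _ => h⟩

/-- Same for h1a. [folklore] -/
theorem withoutFormalLifting_iff (h1b : PadicPridhamSemiregularity) (h3a : FormalVectorBundlesAlgebraize) :
    WithoutFormalLifting ↔ HodgeFermatVarieties :=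
  ⟨fun h => h h1b h3a, fun h _ _ => h⟩

/-- Same for h3a. [folklore] -/
theorem withoutAlgebraization_iff (h1b : PadicPridhamSemiregularity) (h1a : FormalLiftingFromClassLifting) :
    WithoutAlgebraization ↔ HodgeFermatVarieties :=
  ⟨fun h => h h1b h1a, fun h _ _ => h⟩

/-- **No `_false_without_` theorem can exist short of ¬HC**: refuting any weakening refutes the Hodge
conjecture. [folklore] -/
theorem not_hodgeConjecture_of_not_without :
    (¬ WithoutPridham → ¬ _root_.HodgeConjecture) ∧ (¬ WithoutFormalLifting → ¬ _root_.HodgeConjecture) ∧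
      (¬ WithoutAlgebraization → ¬ _root_.HodgeConjecture) ∧ (¬ WithoutEngine → ¬ _root_.HodgeConjecture) :=
  ⟨fun h hc => h fun _ _ => hodgeFermatVarieties_of_hodgeConjecture hc,
    fun h hc => h fun _ _ => hodgeFermatVarieties_of_hodgeConjecture hc,
    fun h hc => h fun _ _ => hodgeFermatVarieties_of_hodgeConjecture hc,
    fun h hc => h (hodgeFermatVarieties_of_hodgeConjecture hc)⟩

/-! ## §2 Degenerate instances of the consequent are free (dimension ≤ 1) -/

/-- HC holds for every smooth projective complex variety of dimension `≤ 1` over the tree's carriers: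
there is no middle codimension (`mem_algebraicClasses_of_extreme`) and Hodge models exist
(`nonempty_hodgeModel_holds`). [folklore] -/
theorem hodgeConjectureFor_of_dim_le_one {n : ℕ} {X : SchemeOver ℂ} (hX : IsSmoothProjective n X)
    (hn : n ≤ 1) : HodgeConjectureFor n X :=
  ⟨nonempty_hodgeModel_holds hX, fun r c _ _ => mem_algebraicClasses_of_extreme hX (by omega) c⟩

/-- **Fermat points and Fermat curves are free**: the `n ≤ 1` instances of `HodgeFermatVarieties` hold
unconditionally (the Fermat hypothesis is not even used). [folklore] -/
theorem hodgeFermatVarieties_of_dim_le_one :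
    ∀ (n m : ℕ) (X : SchemeOver ℂ), n ≤ 1 → IsFermatVariety n m X → IsSmoothProjective n X →
      HodgeConjectureFor n X :=
  fun _ _ _ hn _ hX => hodgeConjectureFor_of_dim_le_one hX hn

/-- Hence the consequent is equivalent to its restriction to dimension `≥ 2`. [folklore] -/
theorem hodgeFermatVarieties_iff_two_le :
    HodgeFermatVarieties ↔ ∀ (n m : ℕ) (X : SchemeOver ℂ), 2 ≤ n → IsFermatVariety n m X →
      IsSmoothProjective n X → HodgeConjectureFor n X := by
  refine ⟨fun h n m X _ hF hX => h n m X hF hX, fun h n m X hF hX => ?_⟩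
  by_cases hn : 2 ≤ n
  · exact h n m X hn hF hX
  · exact hodgeConjectureFor_of_dim_le_one hX (by omega)

/-! ## §3 The picked line `Sketch` (parallelizable-avatar): what its stubs must and need not carry

Vocabulary: the line's own, imported from `Theorems/PadicSemiregularLiftFermatAnchorAssemblyDefs.lean`
(p96559: `HodgeFermatJacobianPowersAt`, `HasGenuineSpanningAnchor`, `zeroOneSeedClasses`,
`ZeroOneSeedsFor`, `ZeroOneSeedsAtAnchors`). The three registered stubs are, verbatim,
`stub_transfer : (∀ m C 𝒥, HodgeFermatJacobianPowersAt m C 𝒥) → HodgeFermatVarieties`,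
`stub_anchors : ∀ m C 𝒥, IsFermatVariety 1 m C → IsSmoothProjective 1 C → ∀ N,
HasGenuineSpanningAnchor (𝒥.J.powSucc N).dim (𝒥.J.powSucc N).X` and `stub_zeroOneSeeds : ∀ m C 𝒥, … →
∀ N, ZeroOneSeedsAtAnchors (𝒥.J.powSucc N).dim (𝒥.J.powSucc N).X`. -/

section Seeds

variable {p : ℕ} [Fact p.Prime] {k : Type} [Field k] [CharP k p] [PerfectRing k p]

/-- `{0,1}`-seed classes are (⋆)-seed classes granted P1b on the (smooth proper) model. [folklore] -/
theorem zeroOneSeedClasses_subset_starSeedClasses (h1b : PadicPridhamSemiregularity)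
    (C : CrystallineRealization p k) {d : ℕ} {𝒴 : SchemeOver (WittVector p k)}
    (h𝒴 : WittScheme.IsSmoothProperModel d 𝒴) (r : ℕ) :
    zeroOneSeedClasses C 𝒴 r ⊆ starSeedClasses C 𝒴 r :=
  zeroOneSeedClasses_subset_starSeedClasses_of C (fun E hE hsr => h1b p k d 𝒴 h𝒴 E hE hsr) r

/-- `{0,1}`-seeds + P1b ⟹ (⋆)-seeds. [folklore] -/
theorem starSeedsFor_of_zeroOneSeedsFor (h1b : PadicPridhamSemiregularity)
    (C : CrystallineRealization p k) {d : ℕ} {𝒴 : SchemeOver (WittVector p k)}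
    (h𝒴 : WittScheme.IsSmoothProperModel d 𝒴) (h : ZeroOneSeedsFor C d 𝒴) : StarSeedsFor C d 𝒴 :=
  starSeedsFor_of_zeroOneSeedsFor_of C (fun E hE hsr => h1b p k d 𝒴 h𝒴 E hE hsr) h

/-- The engine at one model: (⋆)-seeds + BEK + P1a + P3a ⟹ rational `p`-adic variational Hodge in the
middle degrees (from the landed `bo_mem_span_of_starSeedClasses`). [folklore] -/
theorem rationalPVHCFor_of_starSeedsFor (h1a : FormalLiftingFromClassLifting)
    (h3a : FormalVectorBundlesAlgebraize) (C : CrystallineRealization p k)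
    (hBEK : BlochEsnaultKerzLifting C) {d : ℕ} {𝒴 : SchemeOver (WittVector p k)}
    (hM : ModelHypotheses d 𝒴) (h : StarSeedsFor C d 𝒴) : RationalPVHCFor C d 𝒴 := by
  intro r h1 hr u hu hfil
  obtain ⟨N, hN, hNu⟩ := h r h1 hr u hu hfil
  exact bo_mem_span_of_starSeedClasses h1a h3a C hBEK hM.smoothProper hM.projective hM.large
    hM.torsionFree_structureSheaf hM.torsionFree_hodgeOne hM.cotangent_free hN hNu

end Seeds

/-- **The weaker, merged predicate the composition actually consumes** (quantifier mutation (a)): ONE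
genuine, spanning anchor of `X` carrying `{0,1}`-seeds — an `∃` over anchors instead of
`stub_anchors`' `∃` followed by `stub_zeroOneSeeds`' `∀`. Recommended shape of the line's open stub.
[cite: BlochEsnaultKerz2014pAdic, Thm. 1.3] -/
def AnchoredZeroOneSeeds (n : ℕ) (X : SchemeOver ℂ) : Prop :=
  ∃ D : Anchor n X, D.IsGenuine ∧ D.SpansHodge ∧ ZeroOneSeedsFor D.C n D.𝒴

/-- The registered pair of stubs (at one host) implies the merged `∃`-form. [folklore] -/
theorem anchoredZeroOneSeeds_of_stubs {n : ℕ} {X : SchemeOver ℂ} (hA : HasGenuineSpanningAnchor n X)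
    (hZ : ZeroOneSeedsAtAnchors n X) : AnchoredZeroOneSeeds n X := by
  obtain ⟨D, hD, hS⟩ := hA
  exact ⟨D, hD, hS, hZ D hD⟩

/-- **The merged `∃`-form already gives HC for the host** (granted the engine): the line's
`hodgeConjectureFor_of_anchor`, restated over `AnchoredZeroOneSeeds` — so `stub_zeroOneSeeds`' `∀`
over genuine anchors (exotic realizations `C` included) and `stub_anchors`' separate `∃` are unneeded
strength. [folklore] -/
theorem hodgeConjectureFor_of_anchoredZeroOneSeeds (h1b : PadicPridhamSemiregularity)
    (h1a : FormalLiftingFromClassLifting) (h3a : FormalVectorBundlesAlgebraize)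
    {n : ℕ} {X : SchemeOver ℂ} (hX : IsSmoothProjective n X) (h : AnchoredZeroOneSeeds n X) :
    HodgeConjectureFor n X := by
  obtain ⟨D, hD, hS, hZ⟩ := h
  have hR : RationalPVHCFor D.C n D.𝒴 :=
    rationalPVHCFor_of_starSeedsFor h1a h3a D.C hD.bek (D.modelHypotheses hD)
      (starSeedsFor_of_zeroOneSeedsFor h1b D.C D.model hZ)
  have hmid : MiddleCyclePart n X := D.middleCyclePart_of_rationalPVHCFor hD hS hR
  refine ⟨nonempty_hodgeModel_holds hX, fun r c hc hH => ?_⟩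
  by_cases hr : 1 ≤ r ∧ r < n
  · exact hmid r hr.1 hr.2 c hc hH
  · exact mem_algebraicClasses_of_extreme hX (by omega) c

/-- **What the seeds force at a tight anchor** (tightness transferred to this line): at a genuine,
spanning anchor with B2 (`UHdgAreHodge`) and cycle descent, `{0,1}`-seeds + engine give
`RationalPVHCFor`, which there is EQUIVALENT to the middle cycle part of HC for the host
(`rationalPVHCFor_iff_middleCyclePart`). So the open stub is at least "HC in the middle degrees for
every power of every Fermat Jacobian", and object-level on top of it. [folklore] -/
theorem seeds_force_middleCyclePart (h1b : PadicPridhamSemiregularity)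
    (h1a : FormalLiftingFromClassLifting) (h3a : FormalVectorBundlesAlgebraize)
    {n : ℕ} {X : SchemeOver ℂ} (D : Anchor n X) (hD : D.IsGenuine) (hS : D.SpansHodge)
    (hZ : ZeroOneSeedsFor D.C n D.𝒴) : MiddleCyclePart n X :=
  D.middleCyclePart_of_rationalPVHCFor hD hS
    (rationalPVHCFor_of_starSeedsFor h1a h3a D.C hD.bek (D.modelHypotheses hD)
      (starSeedsFor_of_zeroOneSeedsFor h1b D.C D.model hZ))

/-- … and conversely only the CLASS-level `RationalPVHCFor` comes back from HC of the host at a tight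
anchor (tree theorem), never the object-level `ZeroOneSeedsFor`: the seed stub is strictly stronger than
what the anchor can return. [folklore] -/
theorem rationalPVHCFor_of_middleCyclePart' {n : ℕ} {X : SchemeOver ℂ} (D : Anchor n X)
    (hB2 : D.UHdgAreHodge) (hdesc : D.CycleDescent) (hHC : MiddleCyclePart n X) :
    RationalPVHCFor D.C n D.𝒴 :=
  D.rationalPVHCFor_of_middleCyclePart hB2 hdesc hHC

/-- **Seeds are only needed for classes NOT already algebraic on the generic fibre** (hypothesis
mutation for the lead): if every `u ∈ U_Hdg^r` is, up to `N ≠ 0`, a seed combination PLUS a class whose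
Berthelot–Ogus image is already in the `K`-span of algebraic classes of `Y_K`, the engine still returns
`RationalPVHCFor`. The registered stub asks seeds for ALL of `U_Hdg` (Lefschetz part included — that part
is reachable by line bundles anyway, but need not be asked). [folklore] -/
theorem rationalPVHCFor_of_seeds_mod_algebraic (h1b : PadicPridhamSemiregularity)
    (h1a : FormalLiftingFromClassLifting) (h3a : FormalVectorBundlesAlgebraize)
    {p : ℕ} [Fact p.Prime] {k : Type} [Field k] [CharP k p] [PerfectRing k p]
    (C : CrystallineRealization p k) (hBEK : BlochEsnaultKerzLifting C) {d : ℕ}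
    {𝒴 : SchemeOver (WittVector p k)} (hM : ModelHypotheses d 𝒴)
    (h : ∀ (r : ℕ), 1 ≤ r → r < d → ∀ u ∈ C.ratAlgebraicClasses (WittScheme.specialFibre 𝒴) r,
      C.bo 𝒴 (2 * r) u ∈ C.dR.fil (2 * r) r →
      ∃ (N : ℤ) (s v : C.obj (WittScheme.specialFibre 𝒴) (2 * r)), N ≠ 0 ∧ N • u = s + v ∧
        s ∈ AddSubgroup.closure (zeroOneSeedClasses C 𝒴 r) ∧
        C.bo 𝒴 (2 * r) v ∈ Submodule.span K(p, k)
          (C.dR.ratAlgebraicClasses (WittScheme.genericFibre 𝒴) r :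
            Set (C.dR.obj (WittScheme.genericFibre 𝒴) (2 * r)))) :
    RationalPVHCFor C d 𝒴 := by
  intro r h1 hr u hu hfil
  obtain ⟨N, s, v, hN, hNu, hs, hv⟩ := h r h1 hr u hu hfil
  have hs' : (1 : ℤ) • s ∈ AddSubgroup.closure (starSeedClasses C 𝒴 r) := by
    rw [one_zsmul]
    exact AddSubgroup.closure_mono (zeroOneSeedClasses_subset_starSeedClasses h1b C hM.smoothProper r) hs
  have hbs := bo_mem_span_of_starSeedClasses h1a h3a C hBEK hM.smoothProper hM.projective hM.large
    hM.torsionFree_structureSheaf hM.torsionFree_hodgeOne hM.cotangent_free one_ne_zero hs'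
  -- `bo (N • u) = bo s + bo v` lies in the span; divide by `N ≠ 0` in the `K`-vector space.
  have hNbo : (N : K(p, k)) • C.bo 𝒴 (2 * r) u ∈ Submodule.span K(p, k)
      (C.dR.ratAlgebraicClasses (WittScheme.genericFibre 𝒴) r :
        Set (C.dR.obj (WittScheme.genericFibre 𝒴) (2 * r))) := by
    have : C.bo 𝒴 (2 * r) (N • u) = (N : K(p, k)) • C.bo 𝒴 (2 * r) u := by
      rw [map_zsmul, Int.cast_smul_eq_zsmul]
    rw [← this, hNu, map_add]
    exact Submodule.add_mem _ hbs hv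
  have hNK : (N : K(p, k)) ≠ 0 := by exact_mod_cast hN
  exact (Submodule.smul_mem_iff _ hNK).1 hNbo

/-! ### The merged stub at the hosts of the line -/

/-- **Recommended single open stub of the line** (replaces `stub_anchors ∧ stub_zeroOneSeeds`): every
power of a Fermat Jacobian has ONE genuine spanning anchor WITH `{0,1}`-seeds. [folklore] -/
def FermatJacobianAnchoredSeeds : Prop :=
  ∀ (m : ℕ) (C : SchemeOver ℂ) (𝒥 : Jacobian C), IsFermatVariety 1 m C → IsSmoothProjective 1 C →
    ∀ N : ℕ, AnchoredZeroOneSeeds (𝒥.J.powSucc N).dim (𝒥.J.powSucc N).X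

/-- The two registered stubs (statements verbatim) imply the merged stub. [folklore] -/
theorem fermatJacobianAnchoredSeeds_of_stubs
    (hA : ∀ (m : ℕ) (C : SchemeOver ℂ) (𝒥 : Jacobian C), IsFermatVariety 1 m C →
      IsSmoothProjective 1 C → ∀ N : ℕ, HasGenuineSpanningAnchor (𝒥.J.powSucc N).dim (𝒥.J.powSucc N).X)
    (hZ : ∀ (m : ℕ) (C : SchemeOver ℂ) (𝒥 : Jacobian C), IsFermatVariety 1 m C →
      IsSmoothProjective 1 C → ∀ N : ℕ, ZeroOneSeedsAtAnchors (𝒥.J.powSucc N).dim (𝒥.J.powSucc N).X) :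
    FermatJacobianAnchoredSeeds :=
  fun m C 𝒥 hF hC N => anchoredZeroOneSeeds_of_stubs (hA m C 𝒥 hF hC N) (hZ m C 𝒥 hF hC N)

/-- **The merged stub already feeds `stub_transfer`** (granted the engine): HC for every power of every
Fermat Jacobian, i.e. the hypothesis `∀ m C 𝒥, HodgeFermatJacobianPowersAt m C 𝒥` of `stub_transfer`.
So the line closes the crux from `stub_transfer` + `FermatJacobianAnchoredSeeds` + engine, with the
`∀`-anchor quantifier of `stub_zeroOneSeeds` gone. [folklore] -/
theorem hodgeFermatJacobianPowersAt_of_anchoredSeeds (h1b : PadicPridhamSemiregularity)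
    (h1a : FormalLiftingFromClassLifting) (h3a : FormalVectorBundlesAlgebraize)
    (h : FermatJacobianAnchoredSeeds) :
    ∀ (m : ℕ) (C : SchemeOver ℂ) (𝒥 : Jacobian C), HodgeFermatJacobianPowersAt m C 𝒥 :=
  fun m C 𝒥 hF hC N =>
    hodgeConjectureFor_of_anchoredZeroOneSeeds h1b h1a h3a AbelianVariety.isSmoothProjective_holds
      (h m C 𝒥 hF hC N)

/-- **Line composition over the merged stub** (kernel-checked shape for the lead): transfer stub +
merged seed stub ⊢ crux. [folklore] -/
theorem fermatAnchorAssembly_of_transfer_and_anchoredSeeds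
    (transfer : (∀ (m : ℕ) (C : SchemeOver ℂ) (𝒥 : Jacobian C), HodgeFermatJacobianPowersAt m C 𝒥) →
      HodgeFermatVarieties)
    (seeds : FermatJacobianAnchoredSeeds) : FermatAnchorAssembly :=
  fun h1b h1a h3a => transfer (hodgeFermatJacobianPowersAt_of_anchoredSeeds h1b h1a h3a seeds)

/-! ## §4 What a seed must look like at a CM superspecial anchor (paper; for the lead and the next disprover cycle)

Host `X = J(Cₘ)ᴺ⁺¹`, anchor at `p ≡ -1 (m)`, special fibre `A₀` (superspecial), eigenbasis `e_S` of
`H^{2q}` under the CM torus, `Φ` = characters of `H^{1,0}`.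

1. HODGE-CLEANNESS IS "ALL OF ch IS HODGE". For a rational algebraic class `u ∈ R_q` of `A₀` (all classes of
   `A₀` are such), `bo u ∈ F^q` iff `u ∈ ⊕_{Hodge Galois orbits O, |S| = 2q} R_O = U_Hdg^q` (finding 4(c):
   `φ` pairs `S` with `S̄`, so a Tate class in `F^q` has type exactly `(q,q)`, and rationality spreads the
   support over whole Galois orbits). Hence `C.HodgeCondition 𝒴 E` for a seed `E` on `A₀` says: EVERY
   `ch_q(E)` is the crystalline avatar of a Hodge class of `X` — in particular `det E` LIFTS (Berthelot–Ogus
   3.8) even when `E` is assembled from non-liftable line bundles, `ch₂(E)` is a degree-4 Hodge avatar, etc.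
2. ADMISSIBLE CLASSES ARE ABUNDANT; THE WHOLE DIFFICULTY IS SEMIREGULARITY. For any target `u ∈ R_O`
   (`O` an exotic Hodge orbit in degree `2r`) there are finite locally free `E` on `A₀` with
   `ch(E) = N·u + ch(G|_{A₀})` for a vector bundle `G` on `𝒴` (`K₀(A₀) ⊗ ℚ ≅ CH(A₀) ⊗ ℚ`, every class of
   `A₀` is algebraic, and adding restricted bundles of large rank makes the virtual class effective), and
   every such `E` is Hodge-clean with exotic component `N·u` in `ch_r`. So `ZeroOneSeedsFor` at the anchor
   is EXACTLY the existence, for each exotic orbit, of such an `E` that is moreover `{0,1}`-semiregular: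
   `(Tr, Tr(At∘·)) : Ext²(E,E) → H²(𝒪) ⊕ H³(Ω¹)` injective, whence the budget
   `dim Ext²(E,E) ≤ C(g,2) + g·C(g,3)` (`g = dim X`; card rule R4) — big direct sums are excluded, the
   seed must be nearly rigid. Semi-homogeneous summands have `ch = r·exp(c₁/r)`, so an exotic component
   needs ≥ 3 independent non-liftable slopes with degreewise cancellations (card rules R1, R2); nothing in
   this file contradicts the card's isotypic-slope ansatz, and nothing supports it either.
3. WHAT WOULD KILL THE LINE (targets for the next disprover cycle, cheapest first): (i) the card's own
   finite search at `(m, host, p) = (57, B₃ × B₆, 113)` coming back EMPTY kills the semi-homogeneous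
   ansatz only; (ii) a proof that on superspecial `E^g` every `{0,1}`-semiregular finite locally free `E`
   with liftable `det` has `ch(E)` in the `ℚ`-algebra generated by `U_Hdg¹` (liftable divisors) would kill
   `stub_zeroOneSeeds` outright at every host carrying an exotic orbit (paper conjecture-grade; the complex
   analogue with `B¹ = ℚθ`, `B² = ℚθ²` is Finding 14 of Cruxes/HodgeAbelianVarieties, whose mechanism is
   void here by 4(d)); (iii) a refutation of typed P1b at rank 2 on `Ẽ × Ẽ / W(𝔽̄₁₁)` (route kill criterion
   (a)) makes the crux vacuously TRUE and the route dead — it is the only way the crux itself can become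
   cheap.
-/

end Summit.HodgeConjecture.HodgeConjecture.Cruxes.FermatAnchorAssembly.Disproof

end
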